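import Literature.MathematicalPhysics.QuantumFieldTheory.Balaban1983to89.B12Plaquette343
import Literature.MathematicalPhysics.QuantumFieldTheory.Balaban1983to89.B8CurlGradHolonomy
import Literature.MathematicalPhysics.QuantumFieldTheory.Balaban1983to89.Beta.BackgroundVertices

/-!
# Bałaban, *Renormalization group approach to lattice gauge field theories. I* (CMP 109, 1987), p. 272, the sentence
# before (3.14): condition (iii) of the space `U^c_j` for the product configuration `exp iξ𝐀·𝐔` — KERNEL-CHECKED from
# the background plaquette factorisation of B9 p. 390 (3.1) (trace-free form) with an EXPLICIT restriction on `α₂`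

Sources reproduced (statement level + kernel bookkeeping; nothing of the series is asserted):

* T. Bałaban, *Renormalization group approach to lattice gauge field theories. I. Generation of effective actions in
  a small field approximation and a coupling constant renormalization in four dimensions*, Commun. Math. Phys.
  **109** (1987) 249–301 [`Balaban1987RG1` = B12; renders `b2b-balaban-ref1/pages/1987-cmp109-rg-I-small-field/…-p014-x2.png`
  (p. 262) and `…-p024-x2.png` (p. 272) re-read as images for this module].

  p. 262 [PDF 14], verbatim: *"The space U^c_j(X, α₀, α₁, γ₀) is a union of orbits [(𝐔, 𝐉)] determined by configurations
  𝐔, 𝐉 satisfying the four conditions written below. (i) 𝐔 = U′U, U has values in the group G, |∂U − 1| < α₀ξ² on X, (1.11)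
  … (ii) U′ = exp iξA′, A′ has values in the algebra 𝔤ᶜ, |A′|, |∇^ξ_U A′| < α₁ on X. (1.13) (iii) The configurations 𝐔, 𝐉
  satisfy the bounds |∂𝐔 − 1| < α₀ξ², |𝐉| < γ₀ on X. (1.14)"*.

  p. 272 [PDF 24], verbatim: *"𝐄^{(j)}(X, exp iξ𝐀𝐔, (L^{j−1}η)³𝐉 + Δ^ξ_𝐔𝐀 − P₁𝐀 + 𝐅₁(𝐔, 𝐀)). (3.13) We consider it on the
  space U^c_j(X, 1/2α₀, 1/2α₁, α₀) (notice the different constant in the bound for 𝐉). It is an analytic function on this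
  space, and also an analytic function of 𝐀, for 𝐀, ∇^ξ_𝐔𝐀, Δ^ξ_𝐔𝐀 sufficiently small. These restrictions can be easily
  obtained from the definition of the spaces, and from the form of the expressions in (3.13). Thus, there exists a constant
  α₂, depending on α₀ and on some absolute constants, such that the function (3.13) is analytic in 𝐀, for 𝐀 satisfying the
  conditions |𝐀|, |P₁𝐀|, |∇^ξ_𝐔𝐀|, |Δ^ξ_𝐔𝐀| < α₂ on X. (3.14)"*.

* T. Bałaban, *Propagators for lattice gauge theories in a background field*, Commun. Math. Phys. **99** (1985) 389–434
  [`Balaban1985BackgroundPropagators` = B9; renders `b2b-balaban-ref1/pages/1985-cmp99-background-propagators/…-p002-x2.png`,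
  `…-p003-x2.png` re-read as images]: p. 390 (3.1) *"tr(U′U₀)(∂p) = tr(∂₀U′)((p)_z)U₀(∂p), where for a plaquette p = ⟨x, y, z, w⟩
  we define (p)_z = ⟨z, w, x, y⟩, and (∂₀U′)((p)_z) = R(U₀(x, w))U′(z, w)U′(w, x)U′(x, y)R(U₀(x, y))U′(y, z). Let us recall that
  R(U)X = UXU⁻¹."*; p. 390 bottom *"(D^η_{U₀}A)(b) = η⁻¹(R(U₀(b))A(b₊) − A(b₋))"*; p. 391 (3.4) *"(D^η_{U₀}A)(p) = η⁻¹(A(x, y) +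
  R(U₀(x, y))A(y, z) + R(U₀(x, w))A(z, w) + A(w, x)) … (D^η_{U₀}A)(p_{μν}(x)) = (D^η_{U₀}A)_{μν}(x) = (D^η_{U₀,μ}A_ν)(x) −
  (D^η_{U₀,ν}A_μ)(x)"*; (3.5)
  *"U(x, x′) = U⁻¹(x′, x), A(x, x′) = −A(x′, x)"*; (3.6) *"(∂₀U′)((p)_z) = 1 + iη²(D^η_{U₀}A)(p) − ½η⁴((D^η_{U₀}A)(p))² + …"*; p. 391
  *"This expansion is valid also for configurations A and U₀ with values respectively in the complexified algebra gᶜ and the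
  group Gᶜ"*.

HONEST FRAMING (cell charter).  This module kernel-checks ONE elementary sentence of B12 §3 — the `𝐔`-half of condition (iii)
in the membership claim *"These restrictions can be easily obtained from the definition of the spaces"* (GAPS G-adv9-2, item
(iii), certified there BY HAND as «‖∂(e^{iξA}U) − 1‖ ≤ ½α₀ξ² + O(ξ²)(‖∇A‖ + ‖A‖²) < α₀ξ² needs O(1)α₂ < ½α₀»).  It is finite
algebra and one-variable exponential estimates in a Banach algebra.  It is NOT progress on the series' theorems, NOT the
continuum limit, NOT Clay; it discharges nothing of `B12Sec2to5` / `B12.lean`.  The `𝐉`-slot of the same (3.13) membership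
(«|𝐉| < γ₀» of (1.14), with the UN-halved `α₀` of `U^c_j(X, ½α₀, ½α₁, α₀)`; G-adv9-2 item (i)) is typed in `B12Membership313J`
(`jArg_norm_lt`, gen 17) — NOT in `B12CondIIIJ`, whose `jHalf_closes` is the 𝐉-half of Lemma 4 ((3.36)/(3.53), pp. 278–280), a
different membership; condition (ii) is `B12Membership313II` / `…313IILie` / `…313IISL` (gen 17); (i) is not touched; for (iv) see
G-adv9-2: NOT «from the definition».

ABSOLUTE RULE.  No internally-minted statement enters as a cited fact: every theorem below is PROVED here from Mathlib and the
landed tree modules it imports (`Beta.TransportVertices.holonomy`, `B12Plaquette343.elem343`, `B8CurlGradHolonomy.plaqHol` /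
`covCurl` / `adT`, `Beta.BackgroundVertices.expUnit` — all BY NAME); the manuscripts are quoted only to say which printed
display each statement is the skeleton of.  Tags: `[folklore]` for the algebra/analysis, `[cite: Balaban1987RG1, …]` on the
statements that transcribe a printed claim — the cite tag documents WHAT IS TRANSCRIBED, the proof is ours.

WHAT THIS FILE PROVES (any complete normed ℂ-algebra `𝔸`; no commutativity, no `‖1‖ = 1`, no unitarity — the configurations of
B12 §3 are complex, `Gᶜ`-valued, so NO norm bound on the background bond variables `U_i ∈ 𝔸ˣ` is ever used).
Bond labels at the plaquette `p = p_{μν}(x) = ⟨x, x+ξe_μ, z, x+ξe_ν⟩`: `U₁ = 𝐔(x, x+ξe_μ)`, `U₂ = 𝐔(x+ξe_μ, z)`, `U₃ = 𝐔(x+ξe_ν, z)`,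
`U₄ = 𝐔(x, x+ξe_ν)` (units), so `∂𝐔(p) = U₁U₂U₃⁻¹U₄⁻¹` by (3.5); `A₁ = 𝐀_μ(x)`, `A₂ = 𝐀_ν(x+ξe_μ)`, `A₃ = 𝐀_μ(x+ξe_ν)`, `A₄ = 𝐀_ν(x)`;
the product configuration `𝐔′ = exp iξ𝐀·𝐔` has bond variables `e^{iξA_i}U_i` and, by (3.5), reversed bond variables `U_i⁻¹e^{−iξA_i}`.
* §1 `exp_units_conj'` : `exp(u x u⁻¹) = u (exp x) u⁻¹` over ℂ (Mathlib's `exp_units_conj` asks `[NormedAlgebra ℚ 𝔸]`; here from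
  `map_exp_of_mem_ball` and the infinite radius over ℂ) [folklore].
* §2 `plaquette_mul_background` — B9 (3.1) WITHOUT THE TRACE, an exact identity in any complete normed ℂ-algebra:
  `(e^{b₁}U₁)(e^{b₂}U₂)(U₃⁻¹e^{−b₃})(U₄⁻¹e^{−b₄}) = e^{b₁} e^{U₁b₂U₁⁻¹} · (U₁U₂U₃⁻¹U₄⁻¹) · e^{−U₄b₃U₄⁻¹} e^{−b₄}` — the fluctuation
  letters transported to the base point `x` exactly as in `(∂₀U′)((p)_z)` (cyclically the same word), the background plaquette in
  the middle; `dressed_sub_holonomy` splits off the pure-fluctuation holonomy `holonomy [b₁, U₁b₂U₁⁻¹, −U₄b₃U₄⁻¹, −b₄]` of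
  `Beta.TransportVertices`, leaving `e^{b₁}e^{b₂′}(∂𝐔 − 1)e^{−b₃′}e^{−b₄}`; `norm_mul_exp_le`, `norm_dressed_le` bound the dressing
  by `e^{Σ‖b‖}` (no `‖1‖ = 1`).
* §3 `norm_plaquette_mul_background_sub_one_le` (general letters) and `norm_plaquette_expMul_sub_one_le` (`b_i = iξA_i`):
  `‖∂𝐔′(p) − 1‖ ≤ ξ‖(U₁A₂U₁⁻¹ − A₄) − (U₄A₃U₄⁻¹ − A₁)‖ + ½S²ξ²e^{ξS} + e^{ξS}‖∂𝐔(p) − 1‖`,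
  `S = ‖A₁‖ + ‖U₁A₂U₁⁻¹‖ + ‖U₄A₃U₄⁻¹‖ + ‖A₄‖` — the first-order term is `ξ²` times B9's covariant plaquette derivative (3.4)
  (`(U₁A₂U₁⁻¹ − A₄) − (U₄A₃U₄⁻¹ − A₁) = ξ[(∇^ξ_{𝐔,μ}𝐀_ν)(x) − (∇^ξ_{𝐔,ν}𝐀_μ)(x)]`, cf. (3.6)), the second is
  `B12Plaquette343.elem343` BY NAME, the third the dressed background plaquette.
* §4 `norm_plaqHol_expMul_sub_one_le` — the same bound in the LATTICE vocabulary of `B8CurlGradHolonomy` (BY NAME): for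
  transporters `Uμ Uν : S → 𝔸ˣ`, bond fields `Aμ Aν : S → 𝔸` and the product configuration
  `y ↦ expUnit ℂ (iξ•Aμ y) · Uμ y`, `‖plaqHol(𝐔′)(x) − 1‖ ≤ ξ‖covCurl sμ sν (adT Uμ) (adT Uν) Aμ Aν x‖ + ½S²ξ²e^{ξS} +
  e^{ξS}‖plaqHol(𝐔)(x) − 1‖`.
* §5 `budget314` (real arithmetic) and the TRANSCRIPTION `condIII_expMul` [cite: Balaban1987RG1, p. 272 + (1.14) p. 262]:
  if `‖∂𝐔(p) − 1‖ < ½α₀ξ²` ((iii) in `U^c_j(X, ½α₀, ½α₁, α₀)`), `‖𝐀_μ(x)‖, ‖𝐀_ν(x)‖ < α₂` and the two ξ-covariant derivatives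
  entering the plaquette satisfy `‖ξ⁻¹(U₁A₂U₁⁻¹ − A₄)‖, ‖ξ⁻¹(U₄A₃U₄⁻¹ − A₁)‖ < α₂` ((3.14): `|𝐀|, |∇^ξ_𝐔𝐀| < α₂`), and
  `0 < ξ ≤ 1`, `α₀ ≤ 1`, `32·α₂ ≤ α₀`, then `‖∂(exp iξ𝐀·𝐔)(p) − 1‖ < α₀ξ²` — condition (iii) (1.14) for `𝐔′` in
  `U^c_j(X, α₀, α₁, ·)`; lattice form `condIII_plaqHol_expMul`.

READING NOTES (recorded, nothing asserted).  (a) `|∇^ξ_𝐔𝐀| < α₂` is read COMPONENTWISE (each `(∇^ξ_{𝐔,μ}𝐀_ν)(b)` has norm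
`< α₂`) — the weakest reading and the only one the plaquette needs; a Euclidean reading over `μ` implies it.  (b) Only the two
components `𝐀_μ(x)`, `𝐀_ν(x)` of `|𝐀| < α₂` and the two covariant derivatives at `x` are used — `𝐀_ν(x+ξe_μ)`, `𝐀_μ(x+ξe_ν)`
enter only through their transports, which (3.14) controls via `∇^ξ_𝐔`.  (c) The norm is any submultiplicative algebra norm
(operator or Hilbert–Schmidt reading of `|·|`, DIVERGENCE D-r1.1, both qualify).  (d) Versus the hand certificate of G-adv9-2
(iii): for complex `𝐔′` the conjugating exponentials are not isometries, so the background term carries the dressing `e^{ξS}`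
(`e^{ξS}·½α₀ξ²`, an extra `O(α₀α₂ξ³)`), absorbed by the restriction; (e) `32·α₂ ≤ α₀ ≤ 1` is ONE admissible instance of the
print's «α₂ depending on α₀ and on some absolute constants» (the budget closes at ≈ 0.78·α₀ξ²); no optimality is claimed and
`α₀ ≤ 1` is implied by the programme's restrictions on `α₀` (B12 (3.41)–(3.52), `B12ExpSteps`).

Version v1 (b2b-balaban-b12-g16, PAPER SUB-CELL B12 gen 16; journal claim B12-MEMBERSHIP-314-III).  GAPS record C-b12g16-2.
v1.1 (b2b-balaban-b12-g17; DOCSTRINGS ONLY, code byte-identical to v1): cross-read advisories of C-pv22g14-5 applied — V1: the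
second display of B9 (3.4) now quotes its printed middle member «= (D^η_{U₀}A)_{μν}(x)» (render p003 re-read as image); D1: the
`𝐉`-pointer of HONEST FRAMING corrected (the (3.13) 𝐉-slot is `B12Membership313J.jArg_norm_lt`; `B12CondIIIJ.jHalf_closes` is
Lemma 4's 𝐉-half) and the gen-17 (ii)-modules named.
-/

namespace Literature.MathematicalPhysics.QuantumFieldTheory.Balaban1983to89.B12Membership314

open NormedSpace
open Literature.MathematicalPhysics.QuantumFieldTheory.Balaban1983to89
open Literature.MathematicalPhysics.QuantumFieldTheory.Balaban1983to89.Beta.TransportVertices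
open Literature.MathematicalPhysics.QuantumFieldTheory.Balaban1983to89.B8CurlGradHolonomy
open Literature.MathematicalPhysics.QuantumFieldTheory.Balaban1983to89.B12Plaquette343
open Complex (I)

variable {𝔸 : Type*} [NormedRing 𝔸] [NormedAlgebra ℂ 𝔸] [CompleteSpace 𝔸]

/-! ## §1  Conjugation through the exponential, ℂ-coefficients -/

/-- `exp (u x u⁻¹) = u (exp x) u⁻¹` for a unit `u`, in a complete normed ℂ-algebra (B9 p. 390 «R(U)X = UXU⁻¹» commutes with
`exp`): Mathlib's `exp_units_conj` is stated under `[NormedAlgebra ℚ 𝔸]`; over ℂ the exponential series has infinite radius and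
conjugation is a continuous ring homomorphism, so `map_exp_of_mem_ball` applies. [folklore] -/
theorem exp_units_conj' (u : 𝔸ˣ) (x : 𝔸) :
    exp ((u : 𝔸) * x * ↑u⁻¹) = (u : 𝔸) * exp x * ↑u⁻¹ := by
  set f : 𝔸 →+* 𝔸 := MulSemiringAction.toRingHom (ConjAct 𝔸ˣ) 𝔸 (ConjAct.toConjAct u) with hf
  have hf' : ∀ r : 𝔸, f r = (u : 𝔸) * r * ↑u⁻¹ := fun r => by
    simp [hf, ConjAct.units_smul_def]
  have hfc : Continuous f := by
    have h : (f : 𝔸 → 𝔸) = fun r => (u : 𝔸) * r * ↑u⁻¹ := funext hf'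
    rw [h]
    exact (continuous_const.mul continuous_id).mul continuous_const
  have h := map_exp_of_mem_ball f hfc x (Beta.BackgroundVertices.mem_eball_expSeries_radius ℂ x)
  rw [hf', hf'] at h
  exact h.symm

/-- `exp (−(u x u⁻¹)) = u (exp (−x)) u⁻¹`. [folklore] -/
theorem exp_neg_units_conj' (u : 𝔸ˣ) (x : 𝔸) :
    exp (-((u : 𝔸) * x * ↑u⁻¹)) = (u : 𝔸) * exp (-x) * ↑u⁻¹ := by
  rw [show -((u : 𝔸) * x * ↑u⁻¹) = (u : 𝔸) * (-x) * ↑u⁻¹ by rw [mul_neg, neg_mul], exp_units_conj']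

/-! ## §2  The background plaquette factorisation (B9 (3.1), trace-free) and the dressing bounds -/

/-- **B9 p. 390 (3.1) without the trace.**  For bond variables `e^{b_i}U_i` of a product configuration (fluctuation letter on
the LEFT, background unit on the right; reversed bonds contribute inverses `U_i⁻¹e^{−b_i}` by (3.5)):
`(e^{b₁}U₁)(e^{b₂}U₂)(U₃⁻¹e^{−b₃})(U₄⁻¹e^{−b₄}) = e^{b₁}·e^{U₁b₂U₁⁻¹}·(U₁U₂U₃⁻¹U₄⁻¹)·e^{−U₄b₃U₄⁻¹}·e^{−b₄}` — the two far
fluctuation letters transported to the base point by `R(U₀(x,y))`, `R(U₀(x,w))` exactly as in `(∂₀U′)((p)_z)`, the background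
plaquette `U₀(∂p)` in the middle (cyclically the printed word).  Exact, any complete normed ℂ-algebra, `U_i` arbitrary units.
[folklore] -/
theorem plaquette_mul_background (b₁ b₂ b₃ b₄ : 𝔸) (U₁ U₂ U₃ U₄ : 𝔸ˣ) :
    (exp b₁ * U₁) * (exp b₂ * U₂) * (↑U₃⁻¹ * exp (-b₃)) * (↑U₄⁻¹ * exp (-b₄)) =
      exp b₁ * exp ((U₁ : 𝔸) * b₂ * ↑U₁⁻¹) * ((U₁ : 𝔸) * U₂ * ↑U₃⁻¹ * ↑U₄⁻¹) *
        exp (-((U₄ : 𝔸) * b₃ * ↑U₄⁻¹)) * exp (-b₄) := by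
  rw [exp_units_conj', exp_neg_units_conj']
  simp only [mul_assoc, Units.inv_mul_cancel_left]

omit [NormedAlgebra ℂ 𝔸] [CompleteSpace 𝔸] in
/-- Splitting off the pure-fluctuation holonomy: `e^{c₁}e^{c₂}·P·e^{−c₃}e^{−c₄} − holonomy [c₁, c₂, −c₃, −c₄]
= e^{c₁}e^{c₂}(P − 1)e^{−c₃}e^{−c₄}` (`Beta.TransportVertices.holonomy` BY NAME). [folklore] -/
theorem dressed_sub_holonomy (c₁ c₂ c₃ c₄ P : 𝔸) :
    exp c₁ * exp c₂ * P * exp (-c₃) * exp (-c₄) - holonomy [c₁, c₂, -c₃, -c₄] =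
      exp c₁ * exp c₂ * (P - 1) * exp (-c₃) * exp (-c₄) := by
  simp only [holonomy_cons, holonomy_nil, mul_one]
  noncomm_ring

/-- `‖R · exp b‖ ≤ ‖R‖ e^{‖b‖}` without `‖1‖ = 1` (write `R·exp b = R(exp b − 1) + R`; the mirror image of
`Beta.TransportVertices.norm_exp_mul_le`). [folklore] -/
theorem norm_mul_exp_le (R b : 𝔸) : ‖R * exp b‖ ≤ ‖R‖ * Real.exp ‖b‖ := by
  have h : R * exp b = R * (exp b - 1) + R := by noncomm_ring
  have h1 : ‖exp b - 1‖ ≤ Real.exp ‖b‖ - 1 := by simpa using norm_exp_sub_one_le_expTail ℂ b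
  calc ‖R * exp b‖ = ‖R * (exp b - 1) + R‖ := by rw [h]
    _ ≤ ‖R‖ * ‖exp b - 1‖ + ‖R‖ := (norm_add_le _ _).trans (by gcongr; exact norm_mul_le _ _)
    _ ≤ ‖R‖ * (Real.exp ‖b‖ - 1) + ‖R‖ := by gcongr
    _ = ‖R‖ * Real.exp ‖b‖ := by ring

/-- The dressing bound: `‖e^{c₁}e^{c₂}·X·e^{−c₃}e^{−c₄}‖ ≤ e^{‖c₁‖+‖c₂‖+‖c₃‖+‖c₄‖}‖X‖` (no `‖1‖ = 1`, no unitarity). [folklore] -/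
theorem norm_dressed_le (c₁ c₂ c₃ c₄ X : 𝔸) :
    ‖exp c₁ * exp c₂ * X * exp (-c₃) * exp (-c₄)‖ ≤ Real.exp (‖c₁‖ + ‖c₂‖ + ‖c₃‖ + ‖c₄‖) * ‖X‖ := by
  have h12 : ‖exp c₁ * exp c₂ * X‖ ≤ Real.exp ‖c₁‖ * (Real.exp ‖c₂‖ * ‖X‖) := by
    rw [mul_assoc]
    exact (norm_exp_mul_le ℂ c₁ _).trans
      (mul_le_mul_of_nonneg_left (norm_exp_mul_le ℂ c₂ X) (Real.exp_pos _).le)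
  have h3 : ‖exp c₁ * exp c₂ * X * exp (-c₃)‖ ≤ Real.exp ‖c₁‖ * (Real.exp ‖c₂‖ * ‖X‖) * Real.exp ‖c₃‖ := by
    refine (norm_mul_exp_le _ _).trans ?_
    rw [norm_neg]
    exact mul_le_mul_of_nonneg_right h12 (Real.exp_pos _).le
  have h4 : ‖exp c₁ * exp c₂ * X * exp (-c₃) * exp (-c₄)‖ ≤
      Real.exp ‖c₁‖ * (Real.exp ‖c₂‖ * ‖X‖) * Real.exp ‖c₃‖ * Real.exp ‖c₄‖ := by
    refine (norm_mul_exp_le _ _).trans ?_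
    rw [norm_neg]
    exact mul_le_mul_of_nonneg_right h3 (Real.exp_pos _).le
  calc ‖exp c₁ * exp c₂ * X * exp (-c₃) * exp (-c₄)‖
      ≤ Real.exp ‖c₁‖ * (Real.exp ‖c₂‖ * ‖X‖) * Real.exp ‖c₃‖ * Real.exp ‖c₄‖ := h4
    _ = Real.exp (‖c₁‖ + ‖c₂‖ + ‖c₃‖ + ‖c₄‖) * ‖X‖ := by
      simp only [Real.exp_add]; ring

/-! ## §3  The plaquette variable of the product configuration: first-order term + `elem343` + dressed background -/

/-- **General letters.**  `‖(e^{b₁}U₁)(e^{b₂}U₂)(U₃⁻¹e^{−b₃})(U₄⁻¹e^{−b₄}) − 1‖ ≤ ‖holonomy [b₁, b₂′, −b₃′, −b₄] − 1‖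
+ e^{‖b₁‖+‖b₂′‖+‖b₃′‖+‖b₄‖}·‖U₁U₂U₃⁻¹U₄⁻¹ − 1‖`, `b₂′ = U₁b₂U₁⁻¹`, `b₃′ = U₄b₃U₄⁻¹`: the deviation of the product plaquette
from `1` is the deviation of the TRANSPORTED fluctuation holonomy plus the dressed deviation of the background plaquette.
[folklore] -/
theorem norm_plaquette_mul_background_sub_one_le (b₁ b₂ b₃ b₄ : 𝔸) (U₁ U₂ U₃ U₄ : 𝔸ˣ) :
    ‖(exp b₁ * U₁) * (exp b₂ * U₂) * (↑U₃⁻¹ * exp (-b₃)) * (↑U₄⁻¹ * exp (-b₄)) - 1‖ ≤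
      ‖holonomy [b₁, (U₁ : 𝔸) * b₂ * ↑U₁⁻¹, -((U₄ : 𝔸) * b₃ * ↑U₄⁻¹), -b₄] - 1‖ +
        Real.exp (‖b₁‖ + ‖(U₁ : 𝔸) * b₂ * ↑U₁⁻¹‖ + ‖(U₄ : 𝔸) * b₃ * ↑U₄⁻¹‖ + ‖b₄‖) *
          ‖(U₁ : 𝔸) * U₂ * ↑U₃⁻¹ * ↑U₄⁻¹ - 1‖ := by
  rw [plaquette_mul_background]
  set c₂ := (U₁ : 𝔸) * b₂ * ↑U₁⁻¹
  set c₃ := (U₄ : 𝔸) * b₃ * ↑U₄⁻¹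
  set P := (U₁ : 𝔸) * U₂ * ↑U₃⁻¹ * ↑U₄⁻¹
  have hsplit : exp b₁ * exp c₂ * P * exp (-c₃) * exp (-b₄) - 1 =
      (exp b₁ * exp c₂ * P * exp (-c₃) * exp (-b₄) - holonomy [b₁, c₂, -c₃, -b₄]) +
        (holonomy [b₁, c₂, -c₃, -b₄] - 1) := by abel
  rw [hsplit, dressed_sub_holonomy, add_comm]
  exact (norm_add_le _ _).trans (by gcongr; exact norm_dressed_le b₁ c₂ c₃ b₄ (P - 1))

omit [CompleteSpace 𝔸] in
/-- transport commutes with the scalar `iξ`: `U (iξ•A) U⁻¹ = iξ•(U A U⁻¹)`. [folklore] -/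
theorem units_conj_smul (c : ℂ) (u : 𝔸ˣ) (A : 𝔸) :
    (u : 𝔸) * (c • A) * ↑u⁻¹ = c • ((u : 𝔸) * A * ↑u⁻¹) := by
  rw [mul_smul_comm, smul_mul_assoc]

omit [CompleteSpace 𝔸] in
/-- `‖iξ • Y‖ = ξ‖Y‖` for `ξ ≥ 0`. [folklore] -/
theorem norm_I_mul_smul {ξ : ℝ} (hξ : 0 ≤ ξ) (Y : 𝔸) : ‖(I * ξ) • Y‖ = ξ * ‖Y‖ := by
  rw [norm_smul, Complex.norm_mul, Complex.norm_I, one_mul, Complex.norm_real, Real.norm_eq_abs, abs_of_nonneg hξ]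

/-- **The product configuration `exp iξ𝐀·𝐔` at one plaquette** (B9 (3.6) with a proved remainder, any complete normed
ℂ-algebra, arbitrary background units):
`‖(e^{iξA₁}U₁)(e^{iξA₂}U₂)(U₃⁻¹e^{−iξA₃})(U₄⁻¹e^{−iξA₄}) − 1‖ ≤ ξ‖(U₁A₂U₁⁻¹ − A₄) − (U₄A₃U₄⁻¹ − A₁)‖ + ½S²ξ²e^{ξS}
+ e^{ξS}‖U₁U₂U₃⁻¹U₄⁻¹ − 1‖`, `S = ‖A₁‖ + ‖U₁A₂U₁⁻¹‖ + ‖U₄A₃U₄⁻¹‖ + ‖A₄‖`.  The first term is `ξ²·‖(∇^ξ_𝐔𝐀)(p)‖` with B9's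
covariant plaquette derivative (3.4) (`U₁A₂U₁⁻¹ − A₄ = ξ(∇^ξ_{𝐔,μ}𝐀_ν)(x)`, `U₄A₃U₄⁻¹ − A₁ = ξ(∇^ξ_{𝐔,ν}𝐀_μ)(x)`), the second is
`B12Plaquette343.elem343` BY NAME for the transported letters, the third the dressed background plaquette. [folklore] -/
theorem norm_plaquette_expMul_sub_one_le {ξ : ℝ} (hξ : 0 ≤ ξ) (A₁ A₂ A₃ A₄ : 𝔸) (U₁ U₂ U₃ U₄ : 𝔸ˣ) :
    ‖(exp ((I * ξ) • A₁) * U₁) * (exp ((I * ξ) • A₂) * U₂) * (↑U₃⁻¹ * exp (-((I * ξ) • A₃))) *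
          (↑U₄⁻¹ * exp (-((I * ξ) • A₄))) - 1‖ ≤
      ξ * ‖((U₁ : 𝔸) * A₂ * ↑U₁⁻¹ - A₄) - ((U₄ : 𝔸) * A₃ * ↑U₄⁻¹ - A₁)‖ +
        1 / 2 * (‖A₁‖ + ‖(U₁ : 𝔸) * A₂ * ↑U₁⁻¹‖ + ‖(U₄ : 𝔸) * A₃ * ↑U₄⁻¹‖ + ‖A₄‖) ^ 2 * ξ ^ 2 *
          Real.exp (ξ * (‖A₁‖ + ‖(U₁ : 𝔸) * A₂ * ↑U₁⁻¹‖ + ‖(U₄ : 𝔸) * A₃ * ↑U₄⁻¹‖ + ‖A₄‖)) +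
        Real.exp (ξ * (‖A₁‖ + ‖(U₁ : 𝔸) * A₂ * ↑U₁⁻¹‖ + ‖(U₄ : 𝔸) * A₃ * ↑U₄⁻¹‖ + ‖A₄‖)) *
          ‖(U₁ : 𝔸) * U₂ * ↑U₃⁻¹ * ↑U₄⁻¹ - 1‖ := by
  set H₂ := (U₁ : 𝔸) * A₂ * ↑U₁⁻¹ with hH₂
  set H₃ := (U₄ : 𝔸) * A₃ * ↑U₄⁻¹ with hH₃
  set S := ‖A₁‖ + ‖H₂‖ + ‖H₃‖ + ‖A₄‖ with hS
  have h0 := norm_plaquette_mul_background_sub_one_le ((I * ξ) • A₁) ((I * ξ) • A₂) ((I * ξ) • A₃) ((I * ξ) • A₄)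
    U₁ U₂ U₃ U₄
  rw [units_conj_smul, units_conj_smul, ← hH₂, ← hH₃] at h0
  -- the transported fluctuation holonomy: linear term + `elem343`
  have hlin : holonomy [(I * ξ) • A₁, (I * ξ) • H₂, -((I * ξ) • H₃), -((I * ξ) • A₄)] - 1 =
      (holonomy [(I * ξ) • A₁, (I * ξ) • H₂, -((I * ξ) • H₃), -((I * ξ) • A₄)] - 1 - (I * ξ) • (A₁ + H₂ - H₃ - A₄)) +
        (I * ξ) • (A₁ + H₂ - H₃ - A₄) := by abel
  have hhol : ‖holonomy [(I * ξ) • A₁, (I * ξ) • H₂, -((I * ξ) • H₃), -((I * ξ) • A₄)] - 1‖ ≤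
      1 / 2 * S ^ 2 * ξ ^ 2 * Real.exp (ξ * S) + ξ * ‖(H₂ - A₄) - (H₃ - A₁)‖ := by
    rw [hlin]
    refine (norm_add_le _ _).trans (add_le_add (elem343 hξ A₁ H₂ H₃ A₄) ?_)
    rw [norm_I_mul_smul hξ, show A₁ + H₂ - H₃ - A₄ = (H₂ - A₄) - (H₃ - A₁) by abel]
  -- the dressing exponent is `ξ·S`
  have hexp : ‖(I * ξ) • A₁‖ + ‖(I * ξ) • H₂‖ + ‖(I * ξ) • H₃‖ + ‖(I * ξ) • A₄‖ = ξ * S := by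
    simp only [norm_I_mul_smul hξ, hS]; ring
  rw [hexp] at h0
  linarith [h0, hhol]

/-! ## §4  The same bound in the lattice vocabulary of `B8CurlGradHolonomy` (links BY NAME) -/

/-- **Lattice form.**  For transporters `Uμ Uν : S → 𝔸ˣ` along the shifts `sμ sν`, bond fields `Aμ Aν : S → 𝔸` and the product
configuration `𝐔′_μ(y) = expUnit ℂ (iξ•Aμ y) · Uμ y` (likewise `ν`), the plaquette holonomy `B8CurlGradHolonomy.plaqHol` of `𝐔′`
at `x` satisfies `‖plaqHol(𝐔′)(x) − 1‖ ≤ ξ‖covCurl sμ sν (adT Uμ) (adT Uν) Aμ Aν x‖ + ½S²ξ²e^{ξS} + e^{ξS}‖plaqHol(𝐔)(x) − 1‖`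
with `S = ‖Aμ x‖ + ‖Uμ x·Aν(sμ x)·(Uμ x)⁻¹‖ + ‖Uν x·Aμ(sν x)·(Uν x)⁻¹‖ + ‖Aν x‖` — B9 (3.4)'s covariant plaquette derivative
`(D_U A)_{μν}(x) = (D_{U,μ}A_ν)(x) − (D_{U,ν}A_μ)(x)` (η = 1 covariant differences, `B8CurlGradHolonomy.covCurl`/`adT`) is the
first-order term. [folklore] -/
theorem norm_plaqHol_expMul_sub_one_le {S : Type*} (sμ sν : S → S) (Uμ Uν : S → 𝔸ˣ) (Aμ Aν : S → 𝔸)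
    {ξ : ℝ} (hξ : 0 ≤ ξ) (x : S) :
    ‖((plaqHol sμ sν (fun y => Beta.BackgroundVertices.expUnit ℂ ((I * ξ) • Aμ y) * Uμ y)
          (fun y => Beta.BackgroundVertices.expUnit ℂ ((I * ξ) • Aν y) * Uν y) x : 𝔸ˣ) : 𝔸) - 1‖ ≤
      ξ * ‖covCurl sμ sν (adT Uμ) (adT Uν) Aμ Aν x‖ +
        1 / 2 * (‖Aμ x‖ + ‖(Uμ x : 𝔸) * Aν (sμ x) * ↑(Uμ x)⁻¹‖ + ‖(Uν x : 𝔸) * Aμ (sν x) * ↑(Uν x)⁻¹‖ + ‖Aν x‖) ^ 2 *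
          ξ ^ 2 * Real.exp (ξ * (‖Aμ x‖ + ‖(Uμ x : 𝔸) * Aν (sμ x) * ↑(Uμ x)⁻¹‖ +
            ‖(Uν x : 𝔸) * Aμ (sν x) * ↑(Uν x)⁻¹‖ + ‖Aν x‖)) +
        Real.exp (ξ * (‖Aμ x‖ + ‖(Uμ x : 𝔸) * Aν (sμ x) * ↑(Uμ x)⁻¹‖ +
            ‖(Uν x : 𝔸) * Aμ (sν x) * ↑(Uν x)⁻¹‖ + ‖Aν x‖)) *
          ‖((plaqHol sμ sν Uμ Uν x : 𝔸ˣ) : 𝔸) - 1‖ := by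
  have hcurl : covCurl sμ sν (adT Uμ) (adT Uν) Aμ Aν x =
      ((Uμ x : 𝔸) * Aν (sμ x) * ↑(Uμ x)⁻¹ - Aν x) - ((Uν x : 𝔸) * Aμ (sν x) * ↑(Uν x)⁻¹ - Aμ x) := by
    rw [covCurl_apply, adT_smul, adT_smul]
  have hP : ((plaqHol sμ sν Uμ Uν x : 𝔸ˣ) : 𝔸) = (Uμ x : 𝔸) * Uν (sμ x) * ↑(Uμ (sν x))⁻¹ * ↑(Uν x)⁻¹ := by
    simp [plaqHol]
  have hP' : ((plaqHol sμ sν (fun y => Beta.BackgroundVertices.expUnit ℂ ((I * ξ) • Aμ y) * Uμ y)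
      (fun y => Beta.BackgroundVertices.expUnit ℂ ((I * ξ) • Aν y) * Uν y) x : 𝔸ˣ) : 𝔸) =
      (exp ((I * ξ) • Aμ x) * Uμ x) * (exp ((I * ξ) • Aν (sμ x)) * Uν (sμ x)) *
        (↑(Uμ (sν x))⁻¹ * exp (-((I * ξ) • Aμ (sν x)))) * (↑(Uν x)⁻¹ * exp (-((I * ξ) • Aν x))) := by
    simp [plaqHol, mul_inv_rev]
  rw [hcurl, hP, hP']
  exact norm_plaquette_expMul_sub_one_le hξ (Aμ x) (Aν (sμ x)) (Aμ (sν x)) (Aν x) (Uμ x) (Uν (sμ x)) (Uμ (sν x)) (Uν x)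

/-! ## §5  B12 p. 272: condition (iii) for `exp iξ𝐀·𝐔` from (3.14), with an explicit restriction on `α₂` -/

omit [NormedAlgebra ℂ 𝔸] [CompleteSpace 𝔸] in
/-- `‖Y‖ = ξ·‖ξ⁻¹•Y‖` for `ξ > 0` (to read `‖U₁A₂U₁⁻¹ − A₄‖` as `ξ·‖(∇^ξ_{𝐔,μ}𝐀_ν)(x)‖`). [folklore] -/
theorem norm_eq_mul_norm_inv_smul {𝔹 : Type*} [SeminormedAddCommGroup 𝔹] [NormedSpace ℂ 𝔹] {ξ : ℝ} (hξ : 0 < ξ) (Y : 𝔹) :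
    ‖Y‖ = ξ * ‖(ξ : ℂ)⁻¹ • Y‖ := by
  rw [norm_smul, norm_inv, Complex.norm_real, Real.norm_eq_abs, abs_of_pos hξ, ← mul_assoc,
    mul_inv_cancel₀ hξ.ne', one_mul]

/-- **The real-arithmetic budget behind (iii) for `exp iξ𝐀·𝐔`.**  With `0 < ξ ≤ 1`, `0 < α₀ ≤ 1`, `0 ≤ α₂`, `32α₂ ≤ α₀`:
if the first-order term is `l ≤ 2α₂ξ`, the letter size `0 ≤ S ≤ 6α₂` and the background deviation `P < ½α₀ξ²`, then
`ξ·l + ½S²ξ²e^{ξS} + e^{ξS}·P < α₀ξ²` (`e^{6α₂} ≤ 1 + 12α₂ ≤ 11/8`; the budget closes at `< 0.78·α₀ξ²`). [folklore] -/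
theorem budget314 {ξ α₀ α₂ l S P : ℝ} (hξ : 0 < ξ) (hξ1 : ξ ≤ 1) (hα₀ : 0 < α₀) (hα₀1 : α₀ ≤ 1) (hα₂ : 0 ≤ α₂)
    (hres : 32 * α₂ ≤ α₀) (hl : l ≤ 2 * α₂ * ξ) (hS0 : 0 ≤ S) (hS : S ≤ 6 * α₂)
    (hP : P < 1 / 2 * α₀ * ξ ^ 2) :
    ξ * l + 1 / 2 * S ^ 2 * ξ ^ 2 * Real.exp (ξ * S) + Real.exp (ξ * S) * P < α₀ * ξ ^ 2 := by
  have hα₂' : α₂ ≤ 1 / 32 := by linarith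
  -- the exponential factor: `e^{ξS} ≤ e^{6α₂} ≤ 1 + 12α₂`
  have hE1 : Real.exp (ξ * S) ≤ Real.exp (6 * α₂) := by
    apply Real.exp_le_exp.mpr
    calc ξ * S ≤ 1 * (6 * α₂) := by gcongr
      _ = 6 * α₂ := one_mul _
  have hE2 : Real.exp (6 * α₂) ≤ 1 + 12 * α₂ := by
    have habs : |6 * α₂| ≤ 1 := by rw [abs_of_nonneg (by positivity)]; linarith
    have h := Real.abs_exp_sub_one_le habs
    rw [abs_of_nonneg (by positivity : (0:ℝ) ≤ 6 * α₂)] at h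
    linarith [le_abs_self (Real.exp (6 * α₂) - 1)]
  have hE : Real.exp (ξ * S) ≤ 1 + 12 * α₂ := hE1.trans hE2
  have hE0 : 0 < Real.exp (ξ * S) := Real.exp_pos _
  -- term by term
  have h1 : ξ * l ≤ 2 * α₂ * ξ ^ 2 := by nlinarith
  have h2 : 1 / 2 * S ^ 2 * ξ ^ 2 * Real.exp (ξ * S) ≤ 18 * α₂ ^ 2 * ξ ^ 2 * (1 + 12 * α₂) := by
    have hS2 : S ^ 2 ≤ (6 * α₂) ^ 2 := pow_le_pow_left₀ hS0 hS 2
    calc 1 / 2 * S ^ 2 * ξ ^ 2 * Real.exp (ξ * S)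
        ≤ 1 / 2 * (6 * α₂) ^ 2 * ξ ^ 2 * (1 + 12 * α₂) := by gcongr
      _ = 18 * α₂ ^ 2 * ξ ^ 2 * (1 + 12 * α₂) := by ring
  have h3 : Real.exp (ξ * S) * P < (1 + 12 * α₂) * (1 / 2 * α₀ * ξ ^ 2) :=
    (mul_lt_mul_of_pos_left hP hE0).trans_le (mul_le_mul_of_nonneg_right hE (by positivity))
  -- the bracket closes: 2α₂ + 18α₂²(1+12α₂) + ½α₀(1+12α₂) ≤ α₀(1/16 + 198/8192 + 11/16) < α₀
  have hsq : α₂ ^ 2 ≤ α₀ / 1024 := by nlinarith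
  have hξ2 : 0 < ξ ^ 2 := by positivity
  have hbr : 2 * α₂ + 18 * α₂ ^ 2 * (1 + 12 * α₂) + (1 + 12 * α₂) * (1 / 2 * α₀) < α₀ := by nlinarith
  calc ξ * l + 1 / 2 * S ^ 2 * ξ ^ 2 * Real.exp (ξ * S) + Real.exp (ξ * S) * P
      < 2 * α₂ * ξ ^ 2 + 18 * α₂ ^ 2 * ξ ^ 2 * (1 + 12 * α₂) + (1 + 12 * α₂) * (1 / 2 * α₀ * ξ ^ 2) := by
        linarith
    _ = (2 * α₂ + 18 * α₂ ^ 2 * (1 + 12 * α₂) + (1 + 12 * α₂) * (1 / 2 * α₀)) * ξ ^ 2 := by ring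
    _ < α₀ * ξ ^ 2 := (mul_lt_mul_of_pos_right hbr hξ2)

/-- **B12 p. 272, the `𝐔`-half of condition (iii) for the configuration `exp iξ𝐀·𝐔` of (3.13), «easily obtained from the
definition of the spaces», with an EXPLICIT restriction.**  At a plaquette `p = p_{μν}(x)` with background bond units
`U₁ = 𝐔(x,x+ξe_μ)`, `U₂ = 𝐔(x+ξe_μ,z)`, `U₃ = 𝐔(x+ξe_ν,z)`, `U₄ = 𝐔(x,x+ξe_ν)` and `A₁ = 𝐀_μ(x)`, `A₂ = 𝐀_ν(x+ξe_μ)`,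
`A₃ = 𝐀_μ(x+ξe_ν)`, `A₄ = 𝐀_ν(x)`: IF `‖∂𝐔(p) − 1‖ < ½α₀ξ²` (condition (iii) (1.14) in `U^c_j(X, ½α₀, ½α₁, α₀)`),
`‖𝐀_μ(x)‖, ‖𝐀_ν(x)‖ < α₂` and `‖(∇^ξ_{𝐔,μ}𝐀_ν)(x)‖ = ‖ξ⁻¹(U₁A₂U₁⁻¹ − A₄)‖ < α₂`, `‖(∇^ξ_{𝐔,ν}𝐀_μ)(x)‖ = ‖ξ⁻¹(U₄A₃U₄⁻¹ − A₁)‖ < α₂`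
((3.14): `|𝐀|, |∇^ξ_𝐔𝐀| < α₂ on X`, componentwise), and `0 < ξ ≤ 1`, `α₀ ≤ 1`, `32·α₂ ≤ α₀` (ONE admissible instance of
«α₂ depending on α₀ and on some absolute constants»), THEN `‖∂(exp iξ𝐀·𝐔)(p) − 1‖ < α₀ξ²` — condition (iii) (1.14) for
`exp iξ𝐀·𝐔` in `U^c_j(X, α₀, α₁, ·)`.  The `𝐉`-half is `B12CondIIIJ`; (i), (ii), (iv) are not asserted.
[cite: Balaban1987RG1, p. 272 sentence before (3.14) with (1.14) p. 262 — the 𝐔-half of (iii), transcribed; proof ours] -/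
theorem condIII_expMul {ξ α₀ α₂ : ℝ} (hξ : 0 < ξ) (hξ1 : ξ ≤ 1) (hα₀1 : α₀ ≤ 1) (hres : 32 * α₂ ≤ α₀)
    (A₁ A₂ A₃ A₄ : 𝔸) (U₁ U₂ U₃ U₄ : 𝔸ˣ)
    (hU : ‖(U₁ : 𝔸) * U₂ * ↑U₃⁻¹ * ↑U₄⁻¹ - 1‖ < 1 / 2 * α₀ * ξ ^ 2)
    (hA₁ : ‖A₁‖ < α₂) (hA₄ : ‖A₄‖ < α₂)
    (hDμ : ‖(ξ : ℂ)⁻¹ • ((U₁ : 𝔸) * A₂ * ↑U₁⁻¹ - A₄)‖ < α₂)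
    (hDν : ‖(ξ : ℂ)⁻¹ • ((U₄ : 𝔸) * A₃ * ↑U₄⁻¹ - A₁)‖ < α₂) :
    ‖(exp ((I * ξ) • A₁) * U₁) * (exp ((I * ξ) • A₂) * U₂) * (↑U₃⁻¹ * exp (-((I * ξ) • A₃))) *
        (↑U₄⁻¹ * exp (-((I * ξ) • A₄))) - 1‖ < α₀ * ξ ^ 2 := by
  have hα₂ : 0 ≤ α₂ := (norm_nonneg _).trans hA₁.le
  have hα₀ : 0 < α₀ := by
    have h := (norm_nonneg _).trans_lt hU
    nlinarith [sq_nonneg ξ]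
  set H₂ := (U₁ : 𝔸) * A₂ * ↑U₁⁻¹ with hH₂
  set H₃ := (U₄ : 𝔸) * A₃ * ↑U₄⁻¹ with hH₃
  -- the covariant derivatives control the transported letters and the first-order term
  have hμ : ‖H₂ - A₄‖ < ξ * α₂ := by
    rw [norm_eq_mul_norm_inv_smul hξ (H₂ - A₄)]; exact mul_lt_mul_of_pos_left hDμ hξ
  have hν : ‖H₃ - A₁‖ < ξ * α₂ := by
    rw [norm_eq_mul_norm_inv_smul hξ (H₃ - A₁)]; exact mul_lt_mul_of_pos_left hDν hξ
  have hH₂n : ‖H₂‖ ≤ ‖A₄‖ + ‖H₂ - A₄‖ := by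
    simpa [add_comm] using norm_le_norm_add_norm_sub' H₂ A₄
  have hH₃n : ‖H₃‖ ≤ ‖A₁‖ + ‖H₃ - A₁‖ := by
    simpa [add_comm] using norm_le_norm_add_norm_sub' H₃ A₁
  have hl : ‖(H₂ - A₄) - (H₃ - A₁)‖ ≤ 2 * α₂ * ξ := by
    refine (norm_sub_le _ _).trans ?_
    linarith [hμ.le, hν.le]
  have hS0 : 0 ≤ ‖A₁‖ + ‖H₂‖ + ‖H₃‖ + ‖A₄‖ := by positivity
  have hS : ‖A₁‖ + ‖H₂‖ + ‖H₃‖ + ‖A₄‖ ≤ 6 * α₂ := by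
    have hξα : ξ * α₂ ≤ α₂ := by nlinarith
    linarith [hμ.le, hν.le, hA₁.le, hA₄.le]
  have hmain := norm_plaquette_expMul_sub_one_le hξ.le A₁ A₂ A₃ A₄ U₁ U₂ U₃ U₄
  rw [← hH₂, ← hH₃] at hmain
  exact hmain.trans_lt (budget314 hξ hξ1 hα₀ hα₀1 hα₂ hres hl hS0 hS hU)

/-- **Lattice form of `condIII_expMul`** (vocabulary of `B8CurlGradHolonomy`): for the product configuration
`𝐔′ = expUnit ℂ (iξ•𝐀) · 𝐔`, if `‖plaqHol(𝐔)(x) − 1‖ < ½α₀ξ²`, `‖Aμ x‖, ‖Aν x‖ < α₂`, the two ξ-covariant derivatives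
`‖ξ⁻¹ • covD sμ (adT Uμ) Aν x‖, ‖ξ⁻¹ • covD sν (adT Uν) Aμ x‖ < α₂` (B9 p. 390 «(D^η_{U₀}A)(b) = η⁻¹(R(U₀(b))A(b₊) − A(b₋))»),
and `0 < ξ ≤ 1`, `α₀ ≤ 1`, `32·α₂ ≤ α₀`, then `‖plaqHol(𝐔′)(x) − 1‖ < α₀ξ²`.
[cite: Balaban1987RG1, p. 272 sentence before (3.14) with (1.14) p. 262 — the 𝐔-half of (iii), lattice transcription; proof ours] -/
theorem condIII_plaqHol_expMul {S : Type*} (sμ sν : S → S) (Uμ Uν : S → 𝔸ˣ) (Aμ Aν : S → 𝔸) (x : S)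
    {ξ α₀ α₂ : ℝ} (hξ : 0 < ξ) (hξ1 : ξ ≤ 1) (hα₀1 : α₀ ≤ 1) (hres : 32 * α₂ ≤ α₀)
    (hU : ‖((plaqHol sμ sν Uμ Uν x : 𝔸ˣ) : 𝔸) - 1‖ < 1 / 2 * α₀ * ξ ^ 2)
    (hAμ : ‖Aμ x‖ < α₂) (hAν : ‖Aν x‖ < α₂)
    (hDμ : ‖(ξ : ℂ)⁻¹ • covD sμ (adT Uμ) Aν x‖ < α₂) (hDν : ‖(ξ : ℂ)⁻¹ • covD sν (adT Uν) Aμ x‖ < α₂) :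
    ‖((plaqHol sμ sν (fun y => Beta.BackgroundVertices.expUnit ℂ ((I * ξ) • Aμ y) * Uμ y)
        (fun y => Beta.BackgroundVertices.expUnit ℂ ((I * ξ) • Aν y) * Uν y) x : 𝔸ˣ) : 𝔸) - 1‖ < α₀ * ξ ^ 2 := by
  rw [covD_adT_apply] at hDμ hDν
  have hP : ((plaqHol sμ sν Uμ Uν x : 𝔸ˣ) : 𝔸) = (Uμ x : 𝔸) * Uν (sμ x) * ↑(Uμ (sν x))⁻¹ * ↑(Uν x)⁻¹ := by
    simp [plaqHol]
  have hP' : ((plaqHol sμ sν (fun y => Beta.BackgroundVertices.expUnit ℂ ((I * ξ) • Aμ y) * Uμ y)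
      (fun y => Beta.BackgroundVertices.expUnit ℂ ((I * ξ) • Aν y) * Uν y) x : 𝔸ˣ) : 𝔸) =
      (exp ((I * ξ) • Aμ x) * Uμ x) * (exp ((I * ξ) • Aν (sμ x)) * Uν (sμ x)) *
        (↑(Uμ (sν x))⁻¹ * exp (-((I * ξ) • Aμ (sν x)))) * (↑(Uν x)⁻¹ * exp (-((I * ξ) • Aν x))) := by
    simp [plaqHol, mul_inv_rev]
  rw [hP] at hU
  rw [hP']
  exact condIII_expMul hξ hξ1 hα₀1 hres (Aμ x) (Aν (sμ x)) (Aμ (sν x)) (Aν x) (Uμ x) (Uν (sμ x)) (Uμ (sν x)) (Uν x)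
    hU hAμ hAν hDμ hDν

end Literature.MathematicalPhysics.QuantumFieldTheory.Balaban1983to89.B12Membership314
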